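import Mathlib
import HarnessLib
import Literature.Analysis.FluidPDE.TaoCascadeNoLow
import Literature.Analysis.FluidPDE.Tao2016AveragedNS.LocalCascadeSolutions
import Literature.Analysis.FluidPDE.Tao2016AveragedNS.RenormalisedCascadeWaves
import Summits.NavierStokesRegularity.NavierStokesRegularity.Theorems.TaoLadderRungTwoBreakEternalRigidityViscBddOneDefs
import Summits.NavierStokesRegularity.NavierStokesRegularity.Theorems.TaoLadderRungTwoBreakEternalRigidityViscBddOneFiringFloor
import Summits.NavierStokesRegularity.NavierStokesRegularity.Theorems.WakeRatchetMinimalViscousBlowupClosedValve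
import Summits.NavierStokesRegularity.NavierStokesRegularity.Theorems.WakeRatchetMinimalViscousBlowupEveryShellFires
import Summits.NavierStokesRegularity.NavierStokesRegularity.Theorems.WakeRatchetMinimalViscousBlowupThresholdContinuity

/-!
# Crux `TaoLadderRungTwoBreak.EternalRigidityViscBddOne` (stmt-NavierStokesRegularity-20420): under TYPE I the next shell is fed only by
# the LOG-TIME LEVEL ACTION of the shell below — `λ^{k+1}‖X_{k+1}(t)‖² ≤ K ∫₀ᵗ λ^k‖X_k(s)‖²/(t⋆−s) ds` (toward item (II) «ratio bound
# g(k+1) ≤ K' g(k)» of the (ω4) census)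

MODEL lattice ODEs only (Tao 2016 §4: the exact NS-scaled `ν`-viscous cascade lattice of a cancelling table with `|α_{··(0,0,1)}| ≤ 1`,
`m = 4`, from a one-shell datum, in the registered vocabulary `ViscousUpTo` / `TypeOne` of the skeleton `85fbfe8e90eea58b`); nothing
here is a statement about the Navier–Stokes equations; no stub, crux or summit is closed (`--supports stmt-NavierStokesRegularity-20420`).

THE POINT.  The inviscid ENERGY CLIMBING `BlowupRigidityOne.tailEnergy_le_sq_action` (⟨20206⟩) bounds the energy above shell `k` by
the squared `L²`-action of shell `k`.  Along a TYPE-I viscous blow-up the bond flux `Π_k = botSum_k` is better controlled: its third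
factor `‖X_{k+1}‖` is `≤ 2CΛ^{−(k+1)}/(t⋆−s)`, so `|Π_k(s)| ≤ 128·C·Λ⁻¹·‖X_k(s)‖²/(t⋆−s)` and the block energy identity
(`hasDerivWithinAt_blockEnergy`, dissipation and top flux only help, `L → ∞` by the (4.5) bound as in `FiringFloor.shellEnergy_le_datum`)
gives

* `normSq_succ_le_typeI_logAction` — clause form: `‖X_{k+1}(t)‖² ≤ 256·C·Λ⁻¹ ∫₀ᵗ ‖X_k(s)‖²/(T−s) ds` for every `k ≥ 0`, `t < T`;
* `level_succ_le_typeOne_logLevelAction` — **in the skeleton's vocabulary**: `ViscousUpTo ε₀ ν α X₀ X t⋆ ∧ TypeOne ε₀ X t⋆`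
  (`α ∈ InTableClass R`) ⟹ `∃ K > 0, ∀ k t, (1+ε₀)^{k+1}‖X_{k+1}(t)‖² ≤ K ∫₀ᵗ (1+ε₀)^k‖X_k(s)‖²/(t⋆−s) ds`.
Since `ds/(t⋆−s) = dσ` is LOG-TIME, the right-hand side is `K·∫ ℓ_k(σ) dσ`, the log-time integral of the a=1 level `ℓ_k = λ^k‖X_k‖²` of the
shell below: the peak level `g(k+1) = sup_t ℓ_{k+1}` is at most `K × (log-time residence of shell k) × g(k)`.  READING for ⟨20420⟩: item (II)
of the (ω4) census (ratio bound `g(k+1) ≤ K'g(k)`, evidence #42) is thereby REDUCED, under (ω3)'s type I, to a bounded LOG-TIME RESIDENCE of each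
shell near its peak level — a clock statement of the same kind as route WakeRatchet's residue (TL)/(FC′) (⟨22743⟩); no new dynamical input
is claimed.  HONEST LABEL: (ω3), (ω4), ⟨20420⟩ and every NS statement remain OPEN; rung 0.
-/

noncomputable section

-- the summit and its single sub-problem share the name (CONVENTIONS §1)
set_option linter.dupNamespace false

open Set Filter Topology MeasureTheory intervalIntegral
open Literature.Analysis.FluidPDE Literature.Analysis.FluidPDE.TaoCascade
open Summit.NavierStokesRegularity.NavierStokesRegularity.Theorems.MinimalViscousBlowup.ThresholdRay
open Summit.NavierStokesRegularity.NavierStokesRegularity.Theorems.EternalRigidityViscBddOne.Birth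
open Summit.NavierStokesRegularity.NavierStokesRegularity.Theorems.EternalRigidityViscBddOne.FiringFloor

namespace Summit.NavierStokesRegularity.NavierStokesRegularity.Theorems.EternalRigidityViscBddOne.TypeOneFeed

/-- **Under type I, shell `k+1` is fed only by the log-time level action of shell `k` (clause form).**  `λ = 1+ε₀ > 1`, `ν ≥ 0`, a
cancelling table with `|α_{··(0,0,1)}| ≤ 1`, a regular trajectory of the `ν`-viscous lattice on `[0,T)` from the one-shell datum `X₀`
(no shells below `0`, (4.5)-regular on every `[0,T']`) obeying the type-I bound `Λ^n|X_{i,n}(t)|(T−t) ≤ C`.  Then for every `k ≥ 0` and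
`t < T`: `‖X_{k+1}(t)‖² ≤ 256·C·Λ⁻¹·∫₀ᵗ ‖X_k(s)‖²/(T−s) ds`.  (Block energy `[k+1,L)`: inflow `|Π_k| ≤ 4³Λ^k‖X_k‖²‖X_{k+1}‖ ≤
128CΛ⁻¹‖X_k‖²/(T−s)`, dissipation `≤ 0`, top flux `≤ 4³M³λ^{−L}` by the (4.5) bound, `L → ∞`.)
[cite: Tao2016AveragedNS, §4 (4.3), proof of (4.13), Lemma 4.1 (4.5), (4.8)–(4.10); §6.4 (self-similar variables)] -/
theorem normSq_succ_le_typeI_logAction {ε₀ ν T C : ℝ} (hε : 0 < ε₀) (hν : 0 ≤ ν) (hC : 0 ≤ C)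
    {α : Fin 4 → Fin 4 → Fin 4 → ℤ × ℤ × ℤ → ℝ} (hcan : IsCancellingCoeff α)
    (hα1 : ∀ i₁ i₂ i₃, |α i₁ i₂ i₃ (0, 0, 1)| ≤ 1) {X₀ : Fin 4 → ℝ} {X : Fin 4 → ℤ → ℝ → ℝ}
    (hcd : ∀ i n, ContDiffOn ℝ 1 (X i n) (Ico 0 T))
    (hinit : ∀ i n, X i n 0 = if n = 0 then X₀ i else 0)
    (hlow : ∀ i n t, n < 0 → X i n t = 0)
    (hmot : ∀ i n t, 0 ≤ t → t < T → derivWithin (X i n) (Ici 0) t =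
      quadTerm ε₀ α X i n t - ν * (1 + ε₀) ^ ((2 : ℝ) * n) * X i n t)
    (hreg : ∀ T' : ℝ, 0 < T' → T' < T → ∃ M : ℝ, ∀ t : ℝ, 0 ≤ t → t ≤ T' →
      ∀ (i : Fin 4) (n : ℤ), (1 + (1 + ε₀) ^ ((10 : ℝ) * n)) * |X i n t| ≤ M)
    (hTI : ∀ t : ℝ, 0 ≤ t → t < T → ∀ (i : Fin 4) (n : ℤ), bigLam ε₀ ^ n * |X i n t| * (T - t) ≤ C) :
    ∀ (k : ℕ) (t : ℝ), 0 ≤ t → t < T →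
      ‖shellVec X ((k : ℤ) + 1) t‖ ^ 2 ≤
        256 * C * (bigLam ε₀)⁻¹ * ∫ s in (0 : ℝ)..t, ‖shellVec X (k : ℤ) s‖ ^ 2 / (T - s) := by
  intro k t ht0 htT
  have hl0 : (0 : ℝ) < 1 + ε₀ := by linarith
  have hl1 : (1 : ℝ) < 1 + ε₀ := by linarith
  have hΛ : 0 < bigLam ε₀ := bigLam_pos (by linarith)
  -- the window `[0, T'']`
  set T'' : ℝ := (t + T) / 2 with hT''
  have hT''0 : 0 < T'' := by rw [hT'']; linarith
  have htT'' : t < T'' := by rw [hT'']; linarith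
  have hT''T : T'' < T := by rw [hT'']; linarith
  have hderW := hasDerivWithinAt_window_of_clauses (ε₀ := ε₀) (ν := ν) (α := α) hcd hmot hT''T
  obtain ⟨M₀, hM₀⟩ := hreg T'' hT''0 hT''T
  set M : ℝ := max M₀ 0 with hMdef
  have hM0 : 0 ≤ M := le_max_right _ _
  have hM : ∀ u : ℝ, 0 ≤ u → u ≤ T'' → ∀ (i : Fin 4) (n : ℤ), (1 + (1 + ε₀) ^ ((10 : ℝ) * n)) * |X i n u| ≤ M :=
    fun u hu huT i n => (hM₀ u hu huT i n).trans (le_max_left _ _)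
  set r : ℝ := (1 + ε₀)⁻¹ with hr
  have hr0 : 0 < r := by rw [hr]; exact inv_pos.2 hl0
  have hr1 : r < 1 := by rw [hr]; exact inv_lt_one_of_one_lt₀ hl1
  have hlow' : ∀ (i : Fin 4) (n : ℤ) (u : ℝ), n < 0 → 0 ≤ u → X i n u = 0 := fun i n u hn _ => hlow i n u hn
  clear_value M T''
  -- continuity of the shells on `[0,T)`
  have hcx : ∀ j : ℤ, ContinuousOn (fun s => shellVec X j s) (Ico 0 T) := by
    intro j
    have hcp : ContinuousOn (fun s => fun i => X i j s) (Ico 0 T) :=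
      continuousOn_pi.2 fun i => (hcd i j).continuousOn
    exact (PiLp.continuous_toLp 2 (fun _ : Fin 4 => ℝ)).comp_continuousOn hcp
  -- type-I amplitude of shell `k+1`: `‖X_{k+1}(s)‖ ≤ 2 C Λ^{-(k+1)} / (T - s)`
  have hamp : ∀ s, 0 ≤ s → s < T →
      ‖shellVec X ((k : ℤ) + 1) s‖ ≤ 2 * (C / (bigLam ε₀ ^ ((k : ℤ) + 1) * (T - s))) := by
    intro s hs0 hsT
    have hpos : 0 < bigLam ε₀ ^ ((k : ℤ) + 1) := zpow_pos hΛ _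
    have hTs : 0 < T - s := by linarith
    refine norm_shellVec_le_two_mul (by positivity) fun j => ?_
    have h := hTI s hs0 hsT j ((k : ℤ) + 1)
    rw [le_div_iff₀ (mul_pos hpos hTs)]
    calc |X j ((k : ℤ) + 1) s| * (bigLam ε₀ ^ ((k : ℤ) + 1) * (T - s))
        = bigLam ε₀ ^ ((k : ℤ) + 1) * |X j ((k : ℤ) + 1) s| * (T - s) := by ring
      _ ≤ C := h
  -- the inflow bound `|Π_k(s)| ≤ 128 C Λ⁻¹ ‖X_k(s)‖² / (T - s)` on `[0,T)`
  have hflux : ∀ s, 0 ≤ s → s < T →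
      |botSum ε₀ α X (k : ℤ) s| ≤ 128 * C * (bigLam ε₀)⁻¹ * (‖shellVec X (k : ℤ) s‖ ^ 2 / (T - s)) := by
    intro s hs0 hsT
    have hTs : 0 < T - s := by linarith
    have hb := abs_botSum_le_norm_shellVec hl0 hα1 X (k : ℤ) s
    have hP : (1 + ε₀) ^ ((5 : ℝ) * ((k : ℕ) : ℤ) / 2) = bigLam ε₀ ^ (k : ℤ) := by
      rw [bigLam, ← Real.rpow_intCast, ← Real.rpow_mul hl0.le]
      congr 1
      push_cast
      ring
    have hΛk : 0 < bigLam ε₀ ^ (k : ℤ) := zpow_pos hΛ _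
    have hz : bigLam ε₀ ^ ((k : ℤ) + 1) = bigLam ε₀ ^ (k : ℤ) * bigLam ε₀ := zpow_add_one₀ hΛ.ne' _
    have hy : 0 ≤ ‖shellVec X (k : ℤ) s‖ ^ 2 := sq_nonneg _
    calc |botSum ε₀ α X (k : ℤ) s|
        ≤ (4 : ℝ) ^ 3 * (1 + ε₀) ^ ((5 : ℝ) * ((k : ℕ) : ℤ) / 2) * ‖shellVec X (k : ℤ) s‖ ^ 2 *
            ‖shellVec X ((k : ℤ) + 1) s‖ := by exact_mod_cast hb
      _ ≤ (4 : ℝ) ^ 3 * bigLam ε₀ ^ (k : ℤ) * ‖shellVec X (k : ℤ) s‖ ^ 2 *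
            (2 * (C / (bigLam ε₀ ^ ((k : ℤ) + 1) * (T - s)))) := by
          rw [hP]
          exact mul_le_mul_of_nonneg_left (hamp s hs0 hsT) (by positivity)
      _ = 128 * C * (bigLam ε₀)⁻¹ * (‖shellVec X (k : ℤ) s‖ ^ 2 / (T - s)) := by
          rw [hz]
          field_simp
          ring
  -- the clamped, globally continuous source `a(w) = 128 C Λ⁻¹ ‖X_k(proj w)‖² / (T - proj w)` and its primitive
  set proj : ℝ → ℝ := fun w => max 0 (min w t) with hproj
  have hproj_mem : ∀ w, proj w ∈ Icc (0 : ℝ) t := fun w =>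
    ⟨le_max_left _ _, max_le ht0 (min_le_right _ _)⟩
  have hproj_id : ∀ w ∈ Icc (0 : ℝ) t, proj w = w := fun w hw => by
    simp only [hproj]; rw [min_eq_left hw.2, max_eq_right hw.1]
  have hproj_cont : Continuous proj := continuous_const.max (continuous_id.min continuous_const)
  set a : ℝ → ℝ := fun w => 128 * C * (bigLam ε₀)⁻¹ * (‖shellVec X (k : ℤ) (proj w)‖ ^ 2 / (T - proj w)) with hadef
  have hacont : Continuous a := by
    have h1 : Continuous fun w => shellVec X (k : ℤ) (proj w) :=
      (hcx k).comp_continuous hproj_cont fun w => ⟨(hproj_mem w).1, lt_of_le_of_lt (hproj_mem w).2 htT⟩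
    have h2 : Continuous fun w => T - proj w := continuous_const.sub hproj_cont
    have h3 : ∀ w, T - proj w ≠ 0 := fun w => by have := (hproj_mem w).2; linarith
    simp only [hadef]
    exact continuous_const.mul ((h1.norm.pow 2).div h2 h3)
  have ha0 : ∀ w, 0 ≤ a w := fun w => by
    have : 0 < T - proj w := by have := (hproj_mem w).2; linarith
    simp only [hadef]; positivity
  have ha_flux : ∀ w ∈ Icc (0 : ℝ) t, |botSum ε₀ α X (k : ℤ) w| ≤ a w := fun w hw => by
    simp only [hadef]; rw [hproj_id w hw]; exact hflux w hw.1 (lt_of_le_of_lt hw.2 htT)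
  set I : ℝ → ℝ := fun w => ∫ s in (0 : ℝ)..w, a s with hIdef
  have hIder : ∀ w, HasDerivAt I (a w) w := fun w =>
    integral_hasDerivAt_right (hacont.intervalIntegrable _ _) (hacont.stronglyMeasurableAtFilter _ _)
      hacont.continuousAt
  -- MAIN STEP: for every `L ≥ k+2`, `½‖X_{k+1}(t)‖² ≤ I t + 4³M³ r^L t`
  have hstep : ∀ L : ℕ, k + 2 ≤ L →
      (1 / 2 : ℝ) * ‖shellVec X ((k : ℤ) + 1) t‖ ^ 2 ≤ I t + (4 : ℝ) ^ 3 * M ^ 3 * r ^ L * t := by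
    intro L hkL
    set cL : ℝ := (4 : ℝ) ^ 3 * M ^ 3 * r ^ L with hcL
    have hcL0 : 0 ≤ cL := by rw [hcL]; positivity
    set EL : ℝ → ℝ := fun w => ∑ j ∈ Finset.Ico (k + 1) L, ∑ i : Fin 4, (1 / 2 : ℝ) * X i j w ^ 2 with hEL
    set DL : ℝ → ℝ := fun u => ν * ∑ j ∈ Finset.Ico (k + 1) L, (1 + ε₀) ^ ((2 : ℝ) * (j : ℤ)) * ∑ i : Fin 4, X i j u ^ 2
      with hDL
    have hELder : ∀ u ∈ Icc (0 : ℝ) T'', HasDerivWithinAt EL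
        (botSum ε₀ α X (k : ℤ) u - botSum ε₀ α X ((L : ℤ) - 1) u - DL u) (Icc 0 T'') u := by
      intro u hu
      have h := hasDerivWithinAt_blockEnergy (ε₀ := ε₀) (ν := ν) hcan (fun i j => hderW i j u hu) (by omega : k + 1 ≤ L)
      have e : (((k + 1 : ℕ) : ℤ) - 1) = (k : ℤ) := by push_cast; ring
      rw [e] at h
      exact h
    have hBLle : ∀ u ∈ Icc (0 : ℝ) T'', |botSum ε₀ α X ((L : ℤ) - 1) u| ≤ cL := by
      intro u hu
      obtain ⟨L', hL'⟩ := Nat.exists_eq_add_of_le (show 1 ≤ L by omega)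
      have h := abs_botSum_le_of_weight10 (m := 4) hε hM0 hα1 (fun i n => hM u hu.1 hu.2 i n) L'
      have e1 : ((L : ℤ) - 1) = (L' : ℤ) := by rw [hL']; push_cast; ring
      have e2 : L' + 1 = L := by omega
      rw [e1]
      calc |botSum ε₀ α X (L' : ℤ) u| ≤ (4 : ℝ) ^ 3 * M ^ 3 * ((1 + ε₀)⁻¹) ^ (L' + 1) := by exact_mod_cast h
        _ = cL := by rw [hcL, hr, e2]
    have hDL0 : ∀ u, 0 ≤ DL u := fun u => by
      rw [hDL]; dsimp only
      exact mul_nonneg hν (Finset.sum_nonneg fun j _ =>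
        mul_nonneg (Real.rpow_nonneg hl0.le _) (Finset.sum_nonneg fun i _ => sq_nonneg _))
    -- the monotone potential `g = I + cL·w − EL` on `[0,t]`
    set g : ℝ → ℝ := fun w => I w + cL * w - EL w with hg
    set g' : ℝ → ℝ := fun u => a u + cL - (botSum ε₀ α X (k : ℤ) u - botSum ε₀ α X ((L : ℤ) - 1) u - DL u) with hg'
    have hgder : ∀ u ∈ Icc (0 : ℝ) t, HasDerivWithinAt g (g' u) (Icc 0 t) u := by
      intro u hu
      have huW : u ∈ Icc (0 : ℝ) T'' := ⟨hu.1, hu.2.trans htT''.le⟩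
      have h1 : HasDerivWithinAt (fun w => I w + cL * w) (a u + cL) (Icc 0 t) u := by
        have h' : HasDerivAt (fun w => I w + cL * w) (a u + cL * 1) u :=
          (hIder u).add ((hasDerivAt_id' u).const_mul cL)
        rw [mul_one] at h'
        exact h'.hasDerivWithinAt
      exact (h1.sub ((hELder u huW).mono (Icc_subset_Icc le_rfl htT''.le)))
    have hg'0 : ∀ u ∈ Icc (0 : ℝ) t, 0 ≤ g' u := by
      intro u hu
      have h1 := hBLle u ⟨hu.1, hu.2.trans htT''.le⟩
      have h2 := hDL0 u
      have h3 := ha_flux u hu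
      rw [hg']; dsimp only
      linarith [neg_abs_le (botSum ε₀ α X ((L : ℤ) - 1) u), le_abs_self (botSum ε₀ α X (k : ℤ) u)]
    have hcont : ContinuousOn g (Icc 0 t) := fun u hu => (hgder u hu).continuousWithinAt
    have hmono : MonotoneOn g (Icc 0 t) := by
      refine monotoneOn_of_hasDerivWithinAt_nonneg (f' := g') (convex_Icc 0 t) hcont ?_ ?_
      · intro u hu
        rw [interior_Icc] at hu ⊢
        exact ((hgder u ⟨hu.1.le, hu.2.le⟩).hasDerivAt (Icc_mem_nhds hu.1 hu.2)).hasDerivWithinAt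
      · intro u hu
        rw [interior_Icc] at hu
        exact hg'0 u ⟨hu.1.le, hu.2.le⟩
    have hEL0 : EL 0 = 0 := by
      rw [hEL]; dsimp only
      refine Finset.sum_eq_zero fun j hj => ?_
      have hj0 : j ≠ 0 := by
        have : k + 1 ≤ j := (Finset.mem_Ico.1 hj).1
        omega
      simp [hinit, hj0]
    have hI0 : I 0 = 0 := by simp [hIdef]
    have hg0 : g 0 = 0 := by rw [hg]; dsimp only; rw [hEL0, hI0]; ring
    have hgt : 0 ≤ g t := by
      rw [← hg0]; exact hmono ⟨le_rfl, ht0⟩ ⟨ht0, le_rfl⟩ ht0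
    have hsingle : (1 / 2 : ℝ) * ‖shellVec X ((k : ℤ) + 1) t‖ ^ 2 ≤ EL t := by
      rw [norm_shellVec_sq, Finset.mul_sum]
      have hkmem : k + 1 ∈ Finset.Ico (k + 1) L := Finset.mem_Ico.mpr ⟨le_rfl, by omega⟩
      have h := Finset.single_le_sum (f := fun j : ℕ => ∑ i : Fin 4, (1 / 2 : ℝ) * X i j t ^ 2)
        (fun j _ => Finset.sum_nonneg fun i _ => by positivity) hkmem
      push_cast at h ⊢
      exact h
    have hELt : EL t ≤ I t + cL * t := by rw [hg] at hgt; dsimp only at hgt; linarith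
    rw [hcL] at hELt
    linarith
  -- `L → ∞`
  have hle : (1 / 2 : ℝ) * ‖shellVec X ((k : ℤ) + 1) t‖ ^ 2 ≤ I t := by
    refine le_of_forall_pos_le_add fun η hη => ?_
    obtain ⟨n, hn⟩ := exists_pow_lt_of_lt_one (show 0 < η / ((4 : ℝ) ^ 3 * M ^ 3 * t + 1) by positivity) hr1
    set L : ℕ := max n (k + 2) with hLdef
    have hkL : k + 2 ≤ L := le_max_right _ _
    have hrL : r ^ L ≤ r ^ n := pow_le_pow_of_le_one hr0.le hr1.le (le_max_left _ _)
    have h := hstep L hkL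
    have hA : 0 ≤ (4 : ℝ) ^ 3 * M ^ 3 * t := by positivity
    have h1 : (4 : ℝ) ^ 3 * M ^ 3 * r ^ L * t ≤ ((4 : ℝ) ^ 3 * M ^ 3 * t) * r ^ n := by
      calc (4 : ℝ) ^ 3 * M ^ 3 * r ^ L * t = ((4 : ℝ) ^ 3 * M ^ 3 * t) * r ^ L := by ring
        _ ≤ ((4 : ℝ) ^ 3 * M ^ 3 * t) * r ^ n := mul_le_mul_of_nonneg_left hrL hA
    have h2 : ((4 : ℝ) ^ 3 * M ^ 3 * t) * r ^ n
        ≤ ((4 : ℝ) ^ 3 * M ^ 3 * t + 1) * (η / ((4 : ℝ) ^ 3 * M ^ 3 * t + 1)) :=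
      mul_le_mul (by linarith) hn.le (pow_nonneg hr0.le _) (by positivity)
    have h3 : ((4 : ℝ) ^ 3 * M ^ 3 * t + 1) * (η / ((4 : ℝ) ^ 3 * M ^ 3 * t + 1)) = η := by field_simp
    linarith
  -- unclamp the primitive
  have hIt : I t = 128 * C * (bigLam ε₀)⁻¹ * ∫ s in (0 : ℝ)..t, ‖shellVec X (k : ℤ) s‖ ^ 2 / (T - s) := by
    have h1 : I t = ∫ s in (0 : ℝ)..t, 128 * C * (bigLam ε₀)⁻¹ * (‖shellVec X (k : ℤ) s‖ ^ 2 / (T - s)) := by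
      refine intervalIntegral.integral_congr fun s hs => ?_
      rw [uIcc_of_le ht0] at hs
      show a s = _
      simp only [hadef]
      rw [hproj_id s hs]
    rw [h1, intervalIntegral.integral_const_mul]
  rw [hIt] at hle
  linarith

/-- **In the skeleton's vocabulary: under type I the level of shell `k+1` is controlled by the LOG-TIME LEVEL ACTION of shell `k`.**
For a table of `InTableClass R`, `ε₀ > 0`, `ν > 0`: `ViscousUpTo ε₀ ν α X₀ X t⋆` and `TypeOne ε₀ X t⋆` give `K > 0` with
`(1+ε₀)^{k+1}‖X_{k+1}(t)‖² ≤ K ∫₀ᵗ (1+ε₀)^k‖X_k(s)‖²/(t⋆−s) ds` for all `k ≥ 0`, `t ∈ [0,t⋆)` (`K = 256·C·(1+ε₀)·Λ⁻¹`, `C` the type-I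
constant).  As `ds/(t⋆−s) = dσ`, the peak a=1 level of shell `k+1` is at most `K ×` the log-time integral of the level of shell `k`: census
item (II) (`g(k+1) ≤ K'g(k)`) follows from a bounded log-time residence of each shell near its peak.  MODEL lattice only.
[cite: Tao2016AveragedNS, §4 (4.3), proof of (4.13), Lemma 4.1 (4.5), (4.8)–(4.10), §6.4; cell vocabulary (stmt-NavierStokesRegularity-20420)] -/
theorem level_succ_le_typeOne_logLevelAction {R ε₀ ν : ℝ} (hε₀ : 0 < ε₀) (hν : 0 < ν)
    {α : Fin 4 → Fin 4 → Fin 4 → ℤ × ℤ × ℤ → ℝ} (hα : InTableClass R α) {X₀ : Fin 4 → ℝ}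
    {X : Fin 4 → ℤ → ℝ → ℝ} {tStar : ℝ} (hV : ViscousUpTo ε₀ ν α X₀ X tStar) (hT1 : TypeOne ε₀ X tStar) :
    ∃ K : ℝ, 0 < K ∧ ∀ (k : ℕ) (t : ℝ), 0 ≤ t → t < tStar →
      (1 + ε₀) ^ (k + 1) * ‖shellVec X ((k : ℤ) + 1) t‖ ^ 2 ≤
        K * ∫ s in (0 : ℝ)..t, (1 + ε₀) ^ k * ‖shellVec X (k : ℤ) s‖ ^ 2 / (tStar - s) := by
  have hl0 : (0 : ℝ) < 1 + ε₀ := by linarith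
  have hΛ : 0 < bigLam ε₀ := bigLam_pos (by linarith)
  obtain ⟨C₀, hC₀⟩ := hT1
  -- a nonnegative type-I constant
  set C : ℝ := max C₀ 0 with hCdef
  have hC : 0 ≤ C := le_max_right _ _
  have hTI : ∀ t : ℝ, 0 ≤ t → t < tStar → ∀ (i : Fin 4) (n : ℤ), bigLam ε₀ ^ n * |X i n t| * (tStar - t) ≤ C :=
    fun t ht0 htT i n => (hC₀ t ht0 htT i n).trans (le_max_left _ _)
  obtain ⟨Z, hZX, hcdZ, hinitZ, hlowZ, hmotZ, hregZ⟩ := zeroNeg_clauses hV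
  have hsv : ∀ (k : ℤ) (t : ℝ), 0 ≤ t → t < tStar → shellVec Z k t = shellVec X k t := fun k t ht0 htT => by
    ext j; rw [shellVec_apply, shellVec_apply, hZX j k t ht0 htT]
  have hTIZ : ∀ t : ℝ, 0 ≤ t → t < tStar → ∀ (i : Fin 4) (n : ℤ), bigLam ε₀ ^ n * |Z i n t| * (tStar - t) ≤ C :=
    fun t ht0 htT i n => by rw [hZX i n t ht0 htT]; exact hTI t ht0 htT i n
  have hα1 : ∀ i₁ i₂ i₃ : Fin 4, |α i₁ i₂ i₃ (0, 0, 1)| ≤ 1 := fun i₁ i₂ i₃ =>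
    abs_le_one_of_inTableClass hα i₁ i₂ i₃ _ (by rw [mem_shiftSet_iff]; simp)
  refine ⟨256 * C * (1 + ε₀) * (bigLam ε₀)⁻¹ + 1, by positivity, fun k t ht0 htT => ?_⟩
  have h := normSq_succ_le_typeI_logAction hε₀ hν.le hC hα.2.1 hα1 hcdZ hinitZ hlowZ hmotZ hregZ hTIZ k t ht0 htT
  rw [hsv _ t ht0 htT] at h
  -- rewrite the integrand through `Z = X` on `[0,t]` and insert the weight `(1+ε₀)^k`
  have hint : ∫ s in (0 : ℝ)..t, ‖shellVec Z (k : ℤ) s‖ ^ 2 / (tStar - s) =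
      ((1 + ε₀) ^ k)⁻¹ * ∫ s in (0 : ℝ)..t, (1 + ε₀) ^ k * ‖shellVec X (k : ℤ) s‖ ^ 2 / (tStar - s) := by
    rw [← intervalIntegral.integral_const_mul]
    refine intervalIntegral.integral_congr fun s hs => ?_
    rw [uIcc_of_le ht0] at hs
    rw [hsv _ s hs.1 (lt_of_le_of_lt hs.2 htT)]
    have hpk : ((1 + ε₀) ^ k)⁻¹ * ((1 + ε₀) ^ k) = 1 := inv_mul_cancel₀ (pow_ne_zero _ hl0.ne')
    show ‖shellVec X (k : ℤ) s‖ ^ 2 / (tStar - s) = ((1 + ε₀) ^ k)⁻¹ * ((1 + ε₀) ^ k * ‖shellVec X (k : ℤ) s‖ ^ 2 / (tStar - s))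
    rw [mul_div_assoc, ← mul_assoc, hpk, one_mul]
  rw [hint] at h
  have hJ0 : 0 ≤ ∫ s in (0 : ℝ)..t, (1 + ε₀) ^ k * ‖shellVec X (k : ℤ) s‖ ^ 2 / (tStar - s) :=
    intervalIntegral.integral_nonneg ht0 fun s hs => by
      have : 0 < tStar - s := by linarith [hs.2]
      positivity
  set J : ℝ := ∫ s in (0 : ℝ)..t, (1 + ε₀) ^ k * ‖shellVec X (k : ℤ) s‖ ^ 2 / (tStar - s) with hJdef
  have hpne : (1 + ε₀) ^ k ≠ 0 := pow_ne_zero _ hl0.ne'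
  have hΛne : bigLam ε₀ ≠ 0 := hΛ.ne'
  have h2 := mul_le_mul_of_nonneg_left h (pow_nonneg hl0.le (k + 1))
  have heq : (1 + ε₀) ^ (k + 1) * (256 * C * (bigLam ε₀)⁻¹ * (((1 + ε₀) ^ k)⁻¹ * J)) =
      256 * C * (1 + ε₀) * (bigLam ε₀)⁻¹ * J := by
    rw [pow_succ]
    field_simp
  rw [heq] at h2
  have hsplit : (256 * C * (1 + ε₀) * (bigLam ε₀)⁻¹ + 1) * J = 256 * C * (1 + ε₀) * (bigLam ε₀)⁻¹ * J + J := by ring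
  rw [hsplit]
  linarith

end Summit.NavierStokesRegularity.NavierStokesRegularity.Theorems.EternalRigidityViscBddOne.TypeOneFeed

end
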